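import Literature.NumberTheory.NumberFields.CompletionLocalDegree
import HarnessLib

/-!
# `∑_{v ∣ v₀} [F_v : K_{v₀}] = [F : K]` for completions of number fields

Topic `Literature/NumberTheory/NumberFields`; a *proofs* file (theorems only). For a finite
extension of number fields `F/K` and a finite place `v₀` of `K`, the local degrees of the
completions of `F` at the places above `v₀` add up to the global degree:
`∑_{v ∣ v₀} [F_v : K_{v₀}] = [F : K]` (Cassels–Fröhlich, Ch. II §10, the corollary
"`∑_{w ∣ v} [L_w : K_v] = [L : K]`" of `L ⊗_K K_v ≅ ∏_{w ∣ v} L_w`; Neukirch, *Algebraic Number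
Theory*, Ch. II (8.4)). Here it is the sum of the local degree formula
`[F_v : K_{v₀}] = e(v|v₀) f(v|v₀)` (`finrank_place_eq_ramificationIdx_mul_inertiaDeg`, file
`CompletionLocalDegree`) over the fundamental identity `∑ e f = [F : K]` (Mathlib
`Ideal.sum_ramification_inertia`, in the tree's form
`sum_ramificationIdx_mul_inertiaDeg_eq_finrank_of_isMaximal`). The tree's Galois-case statement
is `SemiLocal.finrank_eq` (`dim_{K_v} ∏_{w ∣ v} E_w = [E : K]`, via the normal basis); this file
removes the Galois hypothesis.

* `sum_finrank_place_eq_finrank` — `∑_{v : Place K F v₀} [F_v : K_{v₀}] = [F : K]`;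
* `finrank_semiLocal_eq_finrank` — equivalently `dim_{K_{v₀}} ∏_{v ∣ v₀} F_v = [F : K]` for the
  semi-local algebra `SemiLocal K F v₀` WITHOUT the Galois hypothesis of `SemiLocal.finrank_eq`;
* `finrank_place_le_finrank` — in particular `[F_v : K_{v₀}] ≤ [F : K]`.

## References

* J. W. S. Cassels, A. Fröhlich (eds.), *Algebraic Number Theory* (1967), Ch. II §10.
  [CasselsFrohlichANT1967]
* J. Neukirch, *Algebraic Number Theory* (1999), Ch. II (8.4)–(8.5). [NeukirchANT1999]
-/

noncomputable section

open NumberField IsDedekindDomain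
namespace Literature.NumberTheory.NumberFields

open Literature.NumberTheory.Automorphic Literature.NumberTheory.GaloisRepresentations SemiLocal

universe u

variable {K : Type u} [Field K] [NumberField K] {F : Type u} [Field F] [NumberField F]
  [Algebra K F] (v₀ : HeightOneSpectrum (𝓞 K))

omit [NumberField K] [NumberField F] in
/-- The places of `F` above `v₀` correspond bijectively to the primes of `𝓞 F` over `𝔭_{v₀}`
(`w ↦ 𝔭_w`; stated as bijectivity of the evident map, to avoid introducing a definition).
[folklore] -/
private theorem bijective_place_toPrimesOver :
    Function.Bijective (fun w : Place K F v₀ =>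
      (⟨(w : HeightOneSpectrum (𝓞 F)).asIdeal, (w : HeightOneSpectrum (𝓞 F)).isPrime,
        Place.liesOver w⟩ : v₀.asIdeal.primesOver (𝓞 F))) := by
  constructor
  · intro w w' h
    exact Place.ext (HeightOneSpectrum.ext (congrArg Subtype.val h))
  · rintro ⟨P, hP, hover⟩
    refine ⟨⟨⟨P, hP, Ideal.ne_bot_of_liesOver_of_ne_bot v₀.ne_bot P⟩,
      HeightOneSpectrum.ext hover.over.symm⟩, rfl⟩

/-- **`∑_{v ∣ v₀} [F_v : K_{v₀}] = [F : K]`** for a finite extension of number fields `F/K` and a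
finite place `v₀` of `K` (local base-change structures `SemiLocal.algebraPlace`): the sum of the
local degrees `e(v|v₀) f(v|v₀)` is the global degree by the fundamental identity.
[cite: CasselsFrohlichANT1967, Ch. II §10] [cite: NeukirchANT1999, Ch. II (8.4)] -/
theorem sum_finrank_place_eq_finrank :
    ∑ v : Place K F v₀,
        Module.finrank (v₀.adicCompletion K) ((v : HeightOneSpectrum (𝓞 F)).adicCompletion F) =
      Module.finrank K F := by
  haveI : v₀.asIdeal.IsMaximal := v₀.isMaximal
  rw [← sum_ramificationIdx_mul_inertiaDeg_eq_finrank_of_isMaximal K F v₀.asIdeal]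
  refine Fintype.sum_bijective _ (bijective_place_toPrimesOver v₀) _ _ fun v => ?_
  exact finrank_place_eq_ramificationIdx_mul_inertiaDeg v

/-- **`dim_{K_{v₀}} ∏_{v ∣ v₀} F_v = [F : K]`** for the semi-local algebra `SemiLocal K F v₀` of
ANY finite extension of number fields (the tree's `SemiLocal.finrank_eq` assumes `F/K` Galois).
[cite: CasselsFrohlichANT1967, Ch. II §10] -/
theorem finrank_semiLocal_eq_finrank :
    Module.finrank (v₀.adicCompletion K) (SemiLocal K F v₀) = Module.finrank K F := by
  rw [← sum_finrank_place_eq_finrank v₀]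
  haveI : ∀ v : Place K F v₀,
      Module.Finite (v₀.adicCompletion K) ((v : HeightOneSpectrum (𝓞 F)).adicCompletion F) :=
    fun v => by
      haveI := SemiLocal.isScalarTower_place (K := K) (E := F) v
      haveI : ContinuousSMul (v₀.adicCompletion K)
          ((v : HeightOneSpectrum (𝓞 F)).adicCompletion F) :=
        continuousSMul_of_algebraMap _ _ (continuous_adicCompletionOfLiesOver K F v₀ _)
      infer_instance
  exact Module.finrank_pi_fintype (v₀.adicCompletion K)

/-- `[F_v : K_{v₀}] ≤ [F : K]` for every place `v ∣ v₀`.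
[cite: CasselsFrohlichANT1967, Ch. II §10] -/
theorem finrank_place_le_finrank (v : Place K F v₀) :
    Module.finrank (v₀.adicCompletion K) ((v : HeightOneSpectrum (𝓞 F)).adicCompletion F) ≤
      Module.finrank K F := by
  rw [← sum_finrank_place_eq_finrank v₀]
  exact Finset.single_le_sum (f := fun v : Place K F v₀ =>
    Module.finrank (v₀.adicCompletion K) ((v : HeightOneSpectrum (𝓞 F)).adicCompletion F))
    (fun _ _ => Nat.zero_le _) (Finset.mem_univ v)

end Literature.NumberTheory.NumberFields

end
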